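import Literature.NumberTheory.EllipticCurves.SingularModuliIntegral
import Literature.NumberTheory.EllipticCurves.ComplexMultiplicationJInvariantProofs
import HarnessLib

/-!
# `j(τ)` is an algebraic integer for every imaginary quadratic `τ`, and `j(Λ)` for every CM lattice
# (Silverman, *Advanced Topics*, Thm. II.6.1; Cox, *Primes of the form x² + ny²*, Thm. 11.1 (i))

Topic `NumberTheory/EllipticCurves` (complex multiplication).  Theorem-only file (no definition, no
named fact): two repackagings of the tree's `isIntegral_int_formJ` (`SingularModuliIntegral.lean`:
`j(τ_Q)` is integral over `ℤ` for every primitive positive definite form `Q`) in the forms in which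
it is consumed —

* `isIntegral_int_kleinJ_of_quadratic` — if `τ ∈ ℍ` satisfies `Aτ² + Bτ + C = 0` with integers
  `A > 0`, `B`, `C`, then `j(τ)` is an algebraic integer (Cox Thm. 11.1 (i) for the lattice `[1, τ]`,
  a proper ideal of the order `{β : β[1,τ] ⊆ [1,τ]}`; the form may be imprimitive — divide by
  `gcd(A, B, C)`, `exists_isPrimitive_of_quadratic`, and `τ = τ_Q`, `discr_neg_and_heegnerTau_eq`);
* `isIntegral_int_j_of_hasCM` — **Silverman, *Advanced Topics*, Thm. II.6.1 (a)** for complex tori: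
  if the lattice `Λ` of a period pair has complex multiplication, `j(Λ)` is an algebraic integer
  ("Let `E/ℂ` be an elliptic curve with complex multiplication. Then `j(E)` is an algebraic integer";
  via `exists_isPrimitive_j_eq_of_hasCM`, Silverman *AEC* VI.5.5 / Cox Thm. 10.14).

The first restores, on top of the present `SingularModuliIntegral.lean`, the statement
`isIntegral_int_kleinJ_of_quadratic` of the parallel proof of integrality that briefly occupied the
same path (ledger p42447).

## References

* J. H. Silverman, *Advanced Topics in the Arithmetic of Elliptic Curves*, GTM 151 (1994),
  Thm. II.6.1. [SilvermanATAEC1994]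
* D. A. Cox, *Primes of the form x² + ny²*, 2nd ed. (2013), Thm. 10.14, Thm. 11.1 (i). [Cox2013]
-/

noncomputable section

open Polynomial UpperHalfPlane

namespace Literature.NumberTheory.EllipticCurves

open Literature.NumberTheory.QuadraticFields.BinaryQuadraticForm
  Literature.NumberTheory.QuadraticFields.Quadratic Literature.NumberTheory.EllipticCurves.ModularForms

/-- **`j(τ)` is an algebraic integer for imaginary quadratic `τ`** (Cox, Thm. 11.1 (i)): if `τ ∈ ℍ`
satisfies `Aτ² + Bτ + C = 0` with `A, B, C ∈ ℤ`, `A > 0`, then `j(τ)` is integral over `ℤ`.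
[cite: Cox2013, §11.A Thm. 11.1(i)] -/
theorem isIntegral_int_kleinJ_of_quadratic {τ : ℍ} {A B C : ℤ} (hA : 0 < A)
    (h : (A : ℂ) * (τ : ℂ) ^ 2 + B * τ + C = 0) : IsIntegral ℤ (kleinJ τ) := by
  obtain ⟨Q, hQ1, hprim, hQ⟩ := exists_isPrimitive_of_quadratic hA h
  obtain ⟨hdisc, hτQ⟩ := discr_neg_and_heegnerTau_eq (A := Q.1) (B := Q.2.1) (C := Q.2.2) hQ1 hQ
  rw [← hτQ, ← formJ_eq_kleinJ]
  exact isIntegral_int_formJ hQ1 hprim hdisc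

/-- **Silverman, *Advanced Topics*, Thm. II.6.1 (a): the `j`-invariant of a CM lattice is an algebraic
integer** — if the lattice `Λ` of the period pair `L` has complex multiplication (`L.HasCM`: some
non-integer `α` with `αΛ ⊆ Λ`), then `j(Λ) = j(L)` is integral over `ℤ` (`Λ ∼ [1, τ_Q]` for a primitive
positive definite `Q`, `exists_isPrimitive_j_eq_of_hasCM`, and `isIntegral_int_formJ`).
[cite: SilvermanATAEC1994, Thm. II.6.1] [cite: Cox2013, §11.A Thm. 11.1(i)] -/
theorem isIntegral_int_j_of_hasCM {L : PeriodPair} (hL : L.HasCM) : IsIntegral ℤ L.j := by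
  obtain ⟨Q, hQ1, hprim, hdisc, hj⟩ := exists_isPrimitive_j_eq_of_hasCM hL
  rw [hj, ← formJ_def]
  exact isIntegral_int_formJ hQ1 hprim hdisc

end Literature.NumberTheory.EllipticCurves

end
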